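import Summits.AnomalousDissipation.AnomalousDissipation.Theorems.SawtoothPulseCascadeK2ParallelHalfPulse
import Literature.Analysis.FluidPDE.TorusHeatForcedIcc

/-!
# The parallel half-pulse rung of K2″ in classical typing, hypothesis-free: heat profiles exist, so
# every classical linearised response to a parallel residual-comb injection is unamplified by that
# half pulse — and the injection-phase V case of the restated crux `K2LinearisedCascadeGrowth`
(route `AnomalousDissipation/SawtoothPulseCascade`, crux K2″ = stmt-AnomalousDissipation-19696, the
classical restate of 20025; helper — §3 of `SawtoothPulseCascadeK2ParallelShear` / `…ParallelHalfPulse`)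

§2 (`K2Classical.parallel_H_unique` / `_V_unique`) proved the classical parallel half-pulse rung MODULO a
heat profile `h` on the slot with `h(slot start, ·) =` the injected profile.  Here the profile is
constructed (`exists_heatProfile`: the tree's classical well-posedness of the advection–diffusion
equation on `𝕋¹`, `Torus.exists_unique_isClassicalScalarTransportForcedOn_holds`, with zero drift and
zero source, read on the coordinate `y ↦ proj (y e₀)` and translated from `[0, b−a]` to `[a, b]`), so:

* `parallel_H_of_datum` / `parallel_V_of_datum`: for `ν > 0`, EVERY classical solution `(w, q)` of the
  Navier–Stokes equations linearised at the cascade carrier on the H (resp. V) half-slot of phase `j`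
  with a parallel datum `g(x₂) e₁` (resp. `g(x₁) e₂`), `g` smooth and `1`-periodic, stays a parallel
  shear and satisfies `‖w(t)‖²_{L²} ≤ ‖w(slot start)‖²_{L²}` on the slot;
* `shearCombDatum_true_eq` / `shearCombDatum_false_eq`: residual-comb data `ShearCombDatum N hz w₀` ARE
  such parallel profiles;
* `k2_injectionPhase_V`: **the case `J = j₀`, `hz = false` of the restated crux body
  `K2PhaseGrowthClassical P C`** — window `[tInject j₀ false, tStart (j₀+1)]` = the V half-slot — holds
  for every `ν > 0` with factor `1`: `‖w(t)‖² ≤ ‖w₀‖²`, hence (`k2_injectionPhase_V_bound`)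
  `≤ (C e^{σ⋆γ})^{2(j₀+1−j₀)} ‖w₀‖²` whenever `C e^{σ⋆γ} ≥ 1` (the route's `C = 3`).  The `hz = true`
  injection phase also contains the V half, where the Kelvin–Helmholtz content of K2″ lives; on its H
  half `parallel_H_of_datum` gives factor `1`.
-/

-- `Summit.<Summit>.<Problem>` is the tree's mandated summit-side namespace (CONVENTIONS §2); for this
-- single-conjunct summit the two coincide, so the duplicate is deliberate (lakefile: off for `Summits`).
set_option linter.dupNamespace false

noncomputable section

namespace Summit.AnomalousDissipation.AnomalousDissipation.Theorems.SawtoothPulseCascade.K2Classical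

open Set MeasureTheory
open scoped InnerProductSpace ContDiff
open Literature.Analysis Literature.Analysis.FunctionSpaces Literature.Analysis.FluidPDE
open Literature.Analysis.FluidPDE.SawtoothCascade
open Literature.Analysis.FluidPDE.SawtoothCascade.CascadeParams

/-! ## §3a Heat profiles on a compact time interval from smooth periodic data -/

/-- The coordinate vector `y e₀ ∈ ℝ¹` has coordinate `y`. -/
private theorem smul_single_apply_zero (y : ℝ) :
    (y • EuclideanSpace.single (0 : Fin 1) (1 : ℝ)) 0 = y := by
  simp

/-- Every vector of `ℝ¹` is `(v 0) e₀`. -/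
private theorem eq_smul_single (v : EuclideanSpace ℝ (Fin 1)) :
    v = (v 0) • EuclideanSpace.single (0 : Fin 1) (1 : ℝ) := by
  ext i
  fin_cases i
  simp

/-- A `1`-periodic function read through `𝕋¹`: `G (repr (proj (y e₀)) 0) = G y`. -/
private theorem coordFun_proj_smul_single {F : Type*} {G : ℝ → F} (hG : Function.Periodic G 1) (y : ℝ) :
    G (Torus.repr (Torus.proj (y • EuclideanSpace.single (0 : Fin 1) (1 : ℝ))) 0) = G y := by
  have h := Torus.lift_coordFun_apply hG (0 : Fin 1) (y • EuclideanSpace.single (0 : Fin 1) (1 : ℝ))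
  rw [Torus.lift_apply, smul_single_apply_zero] at h
  exact h

/-- The derivative of a `1`-periodic function is `1`-periodic. -/
private theorem periodic_deriv' {g : ℝ → ℝ} (hg : Function.Periodic g 1) : Function.Periodic (deriv g) 1 := by
  intro s
  have h : (fun x => g (x + 1)) = g := funext hg
  rw [← deriv_comp_add_const g 1 s, h]

/-- **Heat profiles exist.** For `a < b`, `ν > 0` and a smooth `1`-periodic `g : ℝ → ℝ` there is
`h : ℝ → ℝ → ℝ`, jointly smooth on `[a, b] × ℝ`, `1`-periodic in space, solving `∂ₜ|_{[a,b]} h = ν ∂²_y h`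
pointwise, with `h(a, ·) = g` (the classical solution of the heat equation on `𝕋¹`,
`Torus.exists_unique_isClassicalScalarTransportForcedOn_holds` with zero drift and source, read on the
coordinate and translated in time). -/
theorem exists_heatProfile {a b : ℝ} (hab : a < b) {ν : ℝ} (hν : 0 < ν) {g : ℝ → ℝ}
    (hg : ContDiff ℝ ∞ g) (hgper : Function.Periodic g 1) :
    ∃ h : ℝ → ℝ → ℝ, ContDiffOn ℝ ∞ (Function.uncurry h) (Icc a b ×ˢ univ) ∧
      (∀ t ∈ Icc a b, Function.Periodic (h t) 1) ∧
      (∀ t ∈ Icc a b, ∀ y, derivWithin (fun τ => h τ y) (Icc a b) t = ν * deriv (deriv (h t)) y) ∧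
      h a = g := by
  set T : ℝ := b - a with hT_def
  have hT : 0 < T := sub_pos.2 hab
  -- the datum on `𝕋¹`
  set θ₀ : UnitAddTorus (Fin 1) → ℝ := fun x => g (Torus.repr x 0) with hθ₀_def
  have hcoord : ContDiff ℝ ∞ fun v : EuclideanSpace ℝ (Fin 1) => v 0 := contDiff_euclidean.1 contDiff_id 0
  have hθ₀ : Torus.IsSmooth θ₀ := by
    have hl : Torus.lift θ₀ = fun v => g (v 0) := funext fun v => Torus.lift_coordFun_apply hgper 0 v
    unfold Torus.IsSmooth
    rw [hl]
    exact hg.comp hcoord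
  -- zero drift and source
  have hu : Torus.IsSmoothSpaceTimeOn (Icc 0 T)
      (fun (_ : ℝ) (_ : UnitAddTorus (Fin 1)) => (0 : EuclideanSpace ℝ (Fin 1))) :=
    Torus.isSmoothSpaceTimeOn_const (Torus.isSmooth_const _) _
  have hdiv : ∀ t ∈ Icc 0 T, Torus.IsDivFree
      ((fun (_ : ℝ) (_ : UnitAddTorus (Fin 1)) => (0 : EuclideanSpace ℝ (Fin 1))) t) := fun t _ x => by
    simp [Torus.divergence, Torus.partialDeriv, Torus.lineDeriv]
  have hs : Torus.IsSmoothSpaceTimeOn (Icc 0 T) (fun (_ : ℝ) (_ : UnitAddTorus (Fin 1)) => (0 : ℝ)) :=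
    Torus.isSmoothSpaceTimeOn_const (Torus.isSmooth_const _) _
  obtain ⟨θ, hθ, hθ0, -⟩ :=
    Literature.Analysis.FluidPDE.Torus.exists_unique_isClassicalScalarTransportForcedOn_holds (d := Fin 1)
      hν hT hu hdiv hs hθ₀
  -- the profile: `h t y = θ (t - a) (proj (y e₀))`
  set e : ℝ → EuclideanSpace ℝ (Fin 1) := fun y => y • EuclideanSpace.single (0 : Fin 1) (1 : ℝ) with he
  have hecd : ContDiff ℝ ∞ e := contDiff_id.smul contDiff_const
  set h : ℝ → ℝ → ℝ := fun t y => θ (t + -a) (Torus.proj (e y)) with hh_def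
  have hpre : (· + -a) ⁻¹' Icc 0 T = Icc a b := by
    rw [Literature.Analysis.FluidPDE.Torus.preimage_add_const_Icc', hT_def]
    congr 1 <;> ring
  -- periodicity in space
  have hper : ∀ t, Function.Periodic (h t) 1 := by
    intro t y
    have h1 : e (y + 1) = e y + Torus.latticeVec (fun _ : Fin 1 => (1 : ℤ)) := by
      ext i
      fin_cases i
      simp [he]
    show θ (t + -a) (Torus.proj (e (y + 1))) = θ (t + -a) (Torus.proj (e y))
    rw [h1, Torus.proj_add_latticeVec]
  -- slices of `θ` are the coordinate functions of the slices of `h`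
  have hslice : ∀ s, θ s = fun x => h (s + a) (Torus.repr x 0) := by
    intro s
    funext x
    simp only [hh_def]
    rw [add_neg_cancel_right]
    congr 1
    rw [he]
    simp only
    rw [← eq_smul_single (Torus.repr x), Torus.proj_repr]
  refine ⟨h, ?_, fun t _ => hper t, fun t ht y => ?_, ?_⟩
  · -- joint smoothness: `uncurry h = stLift θ ∘ (t, y) ↦ (t - a, y e₀)`
    have hφ : ContDiff ℝ ∞ (fun p : ℝ × ℝ => (p.1 + -a, e p.2)) :=
      (contDiff_fst.add contDiff_const).prodMk (hecd.comp contDiff_snd)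
    have hmaps : MapsTo (fun p : ℝ × ℝ => (p.1 + -a, e p.2)) (Icc a b ×ˢ univ) (Icc 0 T ×ˢ univ) := by
      intro p hp
      refine mk_mem_prod ?_ (mem_univ _)
      have hp1 : p.1 ∈ Icc a b := (mem_prod.1 hp).1
      exact ⟨by linarith [hp1.1], by rw [hT_def]; linarith [hp1.2]⟩
    have hcomp := hθ.smooth_scalar.comp hφ.contDiffOn hmaps
    refine hcomp.congr fun p _ => ?_
    rfl
  · -- the heat equation, translated and read on the coordinate
    have ht' : t + -a ∈ Icc 0 T := ⟨by linarith [ht.1], by rw [hT_def]; linarith [ht.2]⟩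
    have hD := Literature.Analysis.FluidPDE.Torus.timeDerivWithin_comp_add_const (Icc 0 T) θ (-a) t
      (Torus.proj (e y))
    rw [hpre] at hD
    -- `derivWithin (fun τ => h τ y) (Icc a b) t` IS the translated time derivative
    have hLHS : derivWithin (fun τ => h τ y) (Icc a b) t =
        Torus.timeDerivWithin (Icc a b) (fun s => θ (s + -a)) t (Torus.proj (e y)) := rfl
    rw [hLHS, hD]
    have htr := hθ.transport (t + -a) ht' (Torus.proj (e y))
    simp only [inner_zero_left, add_zero] at htr
    rw [htr]
    -- the Laplacian of a coordinate function on `𝕋¹`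
    have hHper : Function.Periodic (h t) 1 := hper t
    have hHs : ContDiff ℝ ∞ (h t) := by
      have h1 : Torus.IsSmooth (θ (t + -a)) := hθ.smooth_scalar.isSmooth_slice ht'
      have h2 : Torus.lift (θ (t + -a)) = fun v => h t (v 0) := by
        rw [hslice (t + -a), neg_add_cancel_right]
        exact funext fun v => Torus.lift_coordFun_apply hHper 0 v
      have h3 : ContDiff ℝ ∞ (fun v : EuclideanSpace ℝ (Fin 1) => h t (v 0)) := by
        have := h1
        unfold Torus.IsSmooth at this
        rwa [h2] at this
      have h4 : h t = (fun v : EuclideanSpace ℝ (Fin 1) => h t (v 0)) ∘ e := by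
        funext y
        simp [he]
      rw [h4]
      exact h3.comp hecd
    have hlap : Torus.laplacian (θ (t + -a)) (Torus.proj (e y)) = deriv (deriv (h t)) y := by
      rw [Torus.laplacian_eq_sum_partialDeriv_partialDeriv (hθ.smooth_scalar.isSmooth_slice ht'),
        Fin.sum_univ_one, hslice (t + -a), neg_add_cancel_right]
      have h1 : Torus.partialDeriv 0 (fun x : UnitAddTorus (Fin 1) => h t (Torus.repr x 0)) =
          fun x => deriv (h t) (Torus.repr x 0) :=
        funext fun x => Torus.partialDeriv_coordFun_self hHper 0 x
      rw [h1, Torus.partialDeriv_coordFun_self (periodic_deriv' hHper) 0]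
      exact coordFun_proj_smul_single (periodic_deriv' (periodic_deriv' hHper)) y
    rw [hlap]
  · -- the datum
    funext y
    show θ (a + -a) (Torus.proj (e y)) = g y
    rw [add_neg_cancel, hθ0]
    exact coordFun_proj_smul_single hgper y

/-! ## §3b The parallel half-pulse rung from the datum -/

/-- **Parallel H-injections are unamplified by the H pulse (classical, from the datum).** For
`δ₀ > 0`, `d > 0`, `ν > 0`: every classical solution `(w, q)` of the Navier–Stokes equations linearised
at the cascade carrier on the H half-slot of phase `j` with a horizontal parallel datum
`w(tStart j) = g(x₂) e₁`, `g` smooth and `1`-periodic, is a horizontal parallel shear at every time of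
the slot and satisfies `‖w(t)‖²_{L²} ≤ ‖w(tStart j)‖²_{L²}`. -/
theorem parallel_H_of_datum (P : CascadeParams) (hδ₀ : 0 < P.δ₀) (hd : 0 < P.d) {j : ℕ} {ν : ℝ}
    (hν : 0 < ν) {g : ℝ → ℝ} (hg : ContDiff ℝ ∞ g) (hgper : Function.Periodic g 1)
    {w : ℝ → UnitAddTorus (Fin 2) → EuclideanSpace ℝ (Fin 2)} {q : ℝ → UnitAddTorus (Fin 2) → ℝ}
    (hw : Torus.IsSmoothSpaceTimeOn (Icc (tStart j) (tStart j + tHalf j)) w)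
    (hq : Torus.IsSmoothSpaceTimeOn (Icc (tStart j) (tStart j + tHalf j)) q)
    (hwdiv : ∀ t ∈ Icc (tStart j) (tStart j + tHalf j), Torus.IsDivFree (w t))
    (hlin : ∀ t ∈ Icc (tStart j) (tStart j + tHalf j), ∀ x,
      Torus.timeDerivWithin (Icc (tStart j) (tStart j + tHalf j)) w t x + Torus.convect (P.field t) (w t) x +
        Torus.convect (w t) (P.field t) x = ν • Torus.laplacian (w t) x - Torus.gradient (q t) x)
    (h0 : w (tStart j) = fun y => g (Torus.repr y 1) • EuclideanSpace.single (0 : Fin 2) (1 : ℝ))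
    {t : ℝ} (ht : t ∈ Icc (tStart j) (tStart j + tHalf j)) :
    (∃ H : ℝ → ℝ, ContDiff ℝ ∞ H ∧ Function.Periodic H 1 ∧
        w t = fun y => H (Torus.repr y 1) • EuclideanSpace.single (0 : Fin 2) (1 : ℝ)) ∧
      Torus.vectorL2Sq (w t) ≤ Torus.vectorL2Sq (w (tStart j)) := by
  have hlt : tStart j < tStart j + tHalf j := by linarith [tHalf_pos j]
  obtain ⟨h, hh, hper, heat, ha⟩ := exists_heatProfile hlt hν hg hgper
  have h0' : w (tStart j) = fun y => h (tStart j) (Torus.repr y 1) • EuclideanSpace.single (0 : Fin 2) (1 : ℝ) := by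
    rw [h0, ha]
  obtain ⟨heq, hle⟩ := parallel_H_unique P hδ₀ hd hν.le hh hper heat hw hq hwdiv hlin h0' ht
  exact ⟨⟨h t, contDiff_slice_of_contDiffOn_uncurry hh ht, hper t ht, heq⟩, hle⟩

/-- **Parallel V-injections are unamplified by the V pulse (classical, from the datum)**: as
`parallel_H_of_datum` on the V half-slot `[tStart j + tHalf j, tStart (j+1)]` with a vertical parallel
datum `w(tStart j + tHalf j) = g(x₁) e₂`. -/
theorem parallel_V_of_datum (P : CascadeParams) (hδ₀ : 0 < P.δ₀) (hd : 0 < P.d) {j : ℕ} {ν : ℝ}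
    (hν : 0 < ν) {g : ℝ → ℝ} (hg : ContDiff ℝ ∞ g) (hgper : Function.Periodic g 1)
    {w : ℝ → UnitAddTorus (Fin 2) → EuclideanSpace ℝ (Fin 2)} {q : ℝ → UnitAddTorus (Fin 2) → ℝ}
    (hw : Torus.IsSmoothSpaceTimeOn (Icc (tStart j + tHalf j) (tStart (j + 1))) w)
    (hq : Torus.IsSmoothSpaceTimeOn (Icc (tStart j + tHalf j) (tStart (j + 1))) q)
    (hwdiv : ∀ t ∈ Icc (tStart j + tHalf j) (tStart (j + 1)), Torus.IsDivFree (w t))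
    (hlin : ∀ t ∈ Icc (tStart j + tHalf j) (tStart (j + 1)), ∀ x,
      Torus.timeDerivWithin (Icc (tStart j + tHalf j) (tStart (j + 1))) w t x +
        Torus.convect (P.field t) (w t) x + Torus.convect (w t) (P.field t) x =
          ν • Torus.laplacian (w t) x - Torus.gradient (q t) x)
    (h0 : w (tStart j + tHalf j) = fun y => g (Torus.repr y 0) • EuclideanSpace.single (1 : Fin 2) (1 : ℝ))
    {t : ℝ} (ht : t ∈ Icc (tStart j + tHalf j) (tStart (j + 1))) :
    (∃ H : ℝ → ℝ, ContDiff ℝ ∞ H ∧ Function.Periodic H 1 ∧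
        w t = fun y => H (Torus.repr y 0) • EuclideanSpace.single (1 : Fin 2) (1 : ℝ)) ∧
      Torus.vectorL2Sq (w t) ≤ Torus.vectorL2Sq (w (tStart j + tHalf j)) := by
  have hlt : tStart j + tHalf j < tStart (j + 1) := by rw [tStart_succ]; linarith [tHalf_pos j]
  obtain ⟨h, hh, hper, heat, ha⟩ := exists_heatProfile hlt hν hg hgper
  have h0' : w (tStart j + tHalf j) =
      fun y => h (tStart j + tHalf j) (Torus.repr y 0) • EuclideanSpace.single (1 : Fin 2) (1 : ℝ) := by
    rw [h0, ha]
  obtain ⟨heq, hle⟩ := parallel_V_unique P hδ₀ hd hν.le hh hper heat hw hq hwdiv hlin h0' ht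
  exact ⟨⟨h t, contDiff_slice_of_contDiffOn_uncurry hh ht, hper t ht, heq⟩, hle⟩

/-! ## §3c Residual-comb data, and the injection-phase V case of the restated crux -/

/-- A horizontal residual-comb datum is a horizontal parallel profile `g(x₂) e₁` with `g` smooth and
`1`-periodic. -/
theorem shearCombDatum_true_eq {N : ℕ} {w₀ : UnitAddTorus (Fin 2) → EuclideanSpace ℝ (Fin 2)}
    (hd : ShearCombDatum N true w₀) :
    ∃ g : ℝ → ℝ, ContDiff ℝ ∞ g ∧ Function.Periodic g 1 ∧
      w₀ = fun y => g (Torus.repr y 1) • EuclideanSpace.single (0 : Fin 2) (1 : ℝ) := by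
  obtain ⟨g, hg, hper, -, hw₀⟩ := hd
  refine ⟨g, hg, hper, ?_⟩
  rw [hw₀]
  funext y
  ext i
  fin_cases i <;> simp

/-- A vertical residual-comb datum is a vertical parallel profile `g(x₁) e₂` with `g` smooth and
`1`-periodic. -/
theorem shearCombDatum_false_eq {N : ℕ} {w₀ : UnitAddTorus (Fin 2) → EuclideanSpace ℝ (Fin 2)}
    (hd : ShearCombDatum N false w₀) :
    ∃ g : ℝ → ℝ, ContDiff ℝ ∞ g ∧ Function.Periodic g 1 ∧
      w₀ = fun y => g (Torus.repr y 0) • EuclideanSpace.single (1 : Fin 2) (1 : ℝ) := by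
  obtain ⟨g, hg, hper, -, hw₀⟩ := hd
  refine ⟨g, hg, hper, ?_⟩
  rw [hw₀]
  funext y
  ext i
  fin_cases i <;> simp

/-- **The injection-phase V case of the restated crux K2″, with factor `1`.** For `δ₀ > 0`, `d > 0`,
every `ν > 0`, every phase `j₀` and every vertical residual-comb injection `w₀` at the V start of phase
`j₀` (`hz = false`): every classical linearised response `(w, q)` on the K2″ window
`[tInject j₀ false, tStart (j₀+1)]` (= the V half-slot) with `w(tInject j₀ false) = w₀` satisfies
`‖w(t)‖²_{L²} ≤ ‖w₀‖²_{L²}` on `[max (tInject j₀ false) (tStart j₀), tStart (j₀+1)]` — the binders of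
`K2PhaseGrowthClassical P C` at `J = j₀`, `hz = false`, verbatim. -/
theorem k2_injectionPhase_V (P : CascadeParams) (hδ₀ : 0 < P.δ₀) (hd : 0 < P.d) {ν : ℝ} (hν : 0 < ν)
    (j₀ : ℕ) (w₀ : UnitAddTorus (Fin 2) → EuclideanSpace ℝ (Fin 2))
    (w : ℝ → UnitAddTorus (Fin 2) → EuclideanSpace ℝ (Fin 2)) (q : ℝ → UnitAddTorus (Fin 2) → ℝ)
    (hdat : ShearCombDatum (P.N j₀) false w₀)
    (hw : Torus.IsSmoothSpaceTimeOn (Icc (CascadeParams.tInject j₀ false) (tStart (j₀ + 1))) w)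
    (hq : Torus.IsSmoothSpaceTimeOn (Icc (CascadeParams.tInject j₀ false) (tStart (j₀ + 1))) q)
    (hdiv : ∀ t ∈ Icc (CascadeParams.tInject j₀ false) (tStart (j₀ + 1)), Torus.IsDivFree (w t))
    (hlin : ∀ t ∈ Icc (CascadeParams.tInject j₀ false) (tStart (j₀ + 1)), ∀ x,
      Torus.timeDerivWithin (Icc (CascadeParams.tInject j₀ false) (tStart (j₀ + 1))) w t x +
        Torus.convect (P.field t) (w t) x + Torus.convect (w t) (P.field t) x =
          ν • Torus.laplacian (w t) x - Torus.gradient (q t) x)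
    (h0 : w (CascadeParams.tInject j₀ false) = w₀) :
    ∀ t ∈ Icc (max (CascadeParams.tInject j₀ false) (tStart j₀)) (tStart (j₀ + 1)),
      Torus.vectorL2Sq (w t) ≤ Torus.vectorL2Sq w₀ := by
  have hI : CascadeParams.tInject j₀ false = tStart j₀ + tHalf j₀ := by
    simp only [CascadeParams.tInject, Bool.false_eq_true, ↓reduceIte]
  rw [hI] at hw hq hdiv hlin h0 ⊢
  intro t ht
  obtain ⟨g, hg, hgper, hw₀⟩ := shearCombDatum_false_eq hdat
  have ht' : t ∈ Icc (tStart j₀ + tHalf j₀) (tStart (j₀ + 1)) := ⟨(le_max_left _ _).trans ht.1, ht.2⟩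
  rw [← h0]
  exact (parallel_V_of_datum P hδ₀ hd hν hg hgper hw hq hdiv hlin (h0.trans hw₀) ht').2

/-- **The injection-phase V case in the shape of the crux body.** Under the hypotheses of
`k2_injectionPhase_V` and `1 ≤ C e^{σ⋆γ}` (e.g. the route's `C = 3`):
`‖w(t)‖²_{L²} ≤ (C e^{σ⋆γ})^{2(j₀+1−j₀)} ‖w₀‖²_{L²}` — the conclusion of `K2PhaseGrowthClassical P C` at
`J = j₀`, `hz = false`, for every `ν > 0` (no threshold needed). -/
theorem k2_injectionPhase_V_bound (P : CascadeParams) (hδ₀ : 0 < P.δ₀) (hd : 0 < P.d) {C : ℝ}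
    (hC : 1 ≤ C * Real.exp (sawSigmaStar * P.γ)) {ν : ℝ} (hν : 0 < ν)
    (j₀ : ℕ) (w₀ : UnitAddTorus (Fin 2) → EuclideanSpace ℝ (Fin 2))
    (w : ℝ → UnitAddTorus (Fin 2) → EuclideanSpace ℝ (Fin 2)) (q : ℝ → UnitAddTorus (Fin 2) → ℝ)
    (hdat : ShearCombDatum (P.N j₀) false w₀)
    (hw : Torus.IsSmoothSpaceTimeOn (Icc (CascadeParams.tInject j₀ false) (tStart (j₀ + 1))) w)
    (hq : Torus.IsSmoothSpaceTimeOn (Icc (CascadeParams.tInject j₀ false) (tStart (j₀ + 1))) q)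
    (hdiv : ∀ t ∈ Icc (CascadeParams.tInject j₀ false) (tStart (j₀ + 1)), Torus.IsDivFree (w t))
    (hlin : ∀ t ∈ Icc (CascadeParams.tInject j₀ false) (tStart (j₀ + 1)), ∀ x,
      Torus.timeDerivWithin (Icc (CascadeParams.tInject j₀ false) (tStart (j₀ + 1))) w t x +
        Torus.convect (P.field t) (w t) x + Torus.convect (w t) (P.field t) x =
          ν • Torus.laplacian (w t) x - Torus.gradient (q t) x)
    (h0 : w (CascadeParams.tInject j₀ false) = w₀) :
    ∀ t ∈ Icc (max (CascadeParams.tInject j₀ false) (tStart j₀)) (tStart (j₀ + 1)),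
      Torus.vectorL2Sq (w t) ≤
        (C * Real.exp (sawSigmaStar * P.γ)) ^ (2 * (j₀ + 1 - j₀)) * Torus.vectorL2Sq w₀ := by
  intro t ht
  have h1 := k2_injectionPhase_V P hδ₀ hd hν j₀ w₀ w q hdat hw hq hdiv hlin h0 t ht
  have hE0 : 0 ≤ Torus.vectorL2Sq w₀ := by
    unfold Torus.vectorL2Sq
    exact integral_nonneg fun _ => by positivity
  calc Torus.vectorL2Sq (w t) ≤ 1 * Torus.vectorL2Sq w₀ := by rw [one_mul]; exact h1
    _ ≤ (C * Real.exp (sawSigmaStar * P.γ)) ^ (2 * (j₀ + 1 - j₀)) * Torus.vectorL2Sq w₀ :=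
      mul_le_mul_of_nonneg_right (one_le_pow₀ hC) hE0

end Summit.AnomalousDissipation.AnomalousDissipation.Theorems.SawtoothPulseCascade.K2Classical

end
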